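import Literature.Analysis.Complex.CauchyTaylorBall
import Mathlib.Analysis.Convex.Deriv
import Mathlib.Analysis.Complex.RealDeriv

/-!
# drefute (line `cauchy-griffiths-source-shells`): candidate proof of the lead's `stub_shellCurvatureBudget` (M2)

Exact signature.  Proof: `h = ⅓·(2h) + ⅔·(h/2)` is a convex combination, and
`F(t) = a + bt + Σ Re gᵢ(t) + (K/2)t²` with `K = Σ 8sᵢ/rᵢ²` is CONVEX on `[h/2, 2h]`
(`F'' = Σ Re gᵢ'' + K ≥ 0` by the Cauchy bound `‖gᵢ''(t)‖ ≤ 8sᵢ/rᵢ²` of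
`Literature.Analysis.Complex.norm_iteratedDeriv_two_le_of_forall_mem_ball` applied to `gᵢ − gᵢ(t)`), so
`3F(h) ≤ F(2h) + 2F(h/2)`, i.e. `3E(h) − E(2h) − 2E(h/2) ≤ (K/2)(4 + ½ − 3)h² = 6h²Σsᵢ/rᵢ²`.
(Positive lemma: evidence for the prover, not landed by the refuter.)
-/

open Set Metric Filter
open scoped Topology

namespace DrefuteCurvature

/-- Real part of a holomorphic piece along the real axis: first derivative. -/
theorem hasDerivAt_re_comp {g : ℂ → ℂ} {t : ℝ} (hg : DifferentiableAt ℂ g (t : ℂ)) :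
    HasDerivAt (fun x : ℝ => (g x).re) (deriv g (t : ℂ)).re t :=
  (hg.hasDerivAt).real_of_complex

theorem stub_shellCurvatureBudget_proof : ∀ (E : ℝ → ℝ) (h a b : ℝ) (n : ℕ) (g : Fin n → ℂ → ℂ) (r s : Fin n → ℝ),
    0 < h → (∀ i, 0 < r i) →
    (∀ i, ∀ t ∈ Set.Icc (h / 2) (2 * h), DifferentiableOn ℂ (g i) (Metric.ball (t : ℂ) (r i)) ∧
      ∀ z ∈ Metric.ball (t : ℂ) (r i), ‖g i z - g i t‖ ≤ s i) →
    (∀ t ∈ Set.Icc (h / 2) (2 * h), E t = a + b * t + ∑ i, (g i t).re) →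
    3 * E h - E (2 * h) - 2 * E (h / 2) ≤ 6 * h ^ 2 * ∑ i, s i / r i ^ 2 := by
  intro E h a b n g r s hh hr hg hE
  -- the curvature constant
  set K : ℝ := ∑ i, 8 * s i / r i ^ 2 with hK
  -- the smooth model and its convexification
  set G : ℝ → ℝ := fun t => a + b * t + ∑ i, (g i t).re with hG
  set F : ℝ → ℝ := fun t => G t + K / 2 * t ^ 2 with hF
  have hwin : ∀ t ∈ Set.Icc (h / 2) (2 * h), ∀ i, DifferentiableAt ℂ (g i) (t : ℂ) := fun t ht i =>
    (hg i t ht).1.differentiableAt (isOpen_ball.mem_nhds (mem_ball_self (hr i)))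
  -- Cauchy: second derivatives of the pieces on the window
  have hcauchy : ∀ t ∈ Set.Icc (h / 2) (2 * h), ∀ i, ‖iteratedDeriv 2 (g i) (t : ℂ)‖ ≤ 8 * s i / r i ^ 2 := by
    intro t ht i
    have h1 := Literature.Analysis.Complex.norm_iteratedDeriv_two_le_of_forall_mem_ball (hr i)
      ((hg i t ht).1.sub_const (g i t)) (hg i t ht).2
    have h2 : iteratedDeriv 2 (fun z => g i z - g i (t : ℂ)) = iteratedDeriv 2 (g i) := by
      have hd : deriv (fun z => g i z - g i (t : ℂ)) = deriv (g i) := by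
        funext z; exact deriv_sub_const _
      rw [iteratedDeriv_succ, iteratedDeriv_one, hd, iteratedDeriv_succ, iteratedDeriv_one]
    rwa [h2] at h1
  -- first derivative of G on the window (in fact at every point of the window)
  have hG' : ∀ t ∈ Set.Icc (h / 2) (2 * h),
      HasDerivAt G (b + ∑ i, (deriv (g i) (t : ℂ)).re) t := by
    intro t ht
    have hsum : HasDerivAt (fun x : ℝ => ∑ i, (g i x).re) (∑ i, (deriv (g i) (t : ℂ)).re) t :=
      HasDerivAt.fun_sum fun i _ => hasDerivAt_re_comp (hwin t ht i)
    have hlin : HasDerivAt (fun x : ℝ => a + b * x) b t := by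
      simpa using ((hasDerivAt_id t).const_mul b).const_add a
    rw [hG]
    exact hlin.fun_add hsum
  -- second derivative of the pieces' real parts at interior points
  have hG'' : ∀ x ∈ Set.Ioo (h / 2) (2 * h),
      HasDerivAt (fun t : ℝ => b + ∑ i, (deriv (g i) (t : ℂ)).re) (∑ i, (iteratedDeriv 2 (g i) (x : ℂ)).re) x := by
    intro x hx
    have hx' : x ∈ Set.Icc (h / 2) (2 * h) := Ioo_subset_Icc_self hx
    have hderiv : ∀ i, DifferentiableAt ℂ (deriv (g i)) (x : ℂ) := fun i =>
      ((hg i x hx').1.deriv isOpen_ball).differentiableAt (isOpen_ball.mem_nhds (mem_ball_self (hr i)))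
    have hsum : HasDerivAt (fun t : ℝ => ∑ i, (deriv (g i) (t : ℂ)).re)
        (∑ i, (iteratedDeriv 2 (g i) (x : ℂ)).re) x := by
      refine HasDerivAt.fun_sum fun i _ => ?_
      have := hasDerivAt_re_comp (hderiv i)
      rwa [iteratedDeriv_succ, iteratedDeriv_one]
    exact hsum.const_add b
  -- deriv G agrees with the formula on the open window
  have hderivG : ∀ x ∈ Set.Ioo (h / 2) (2 * h), deriv G x = b + ∑ i, (deriv (g i) (x : ℂ)).re := fun x hx =>
    (hG' x (Ioo_subset_Icc_self hx)).deriv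
  have hF' : ∀ t ∈ Set.Icc (h / 2) (2 * h), HasDerivAt F (b + ∑ i, (deriv (g i) (t : ℂ)).re + K * t) t := by
    intro t ht
    have hq : HasDerivAt (fun t : ℝ => K / 2 * t ^ 2) (K * t) t := by
      have h1 := ((hasDerivAt_id' t).fun_mul (hasDerivAt_id' t)).const_mul (K / 2)
      have h2 : (fun y : ℝ => K / 2 * (y * y)) = fun y => K / 2 * y ^ 2 := by funext y; ring
      have h3 : K / 2 * (1 * t + t * 1) = K * t := by ring
      rw [h2, h3] at h1
      exact h1
    rw [hF]
    exact (hG' t ht).fun_add hq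
  have hderivF : ∀ x ∈ Set.Ioo (h / 2) (2 * h), deriv F x = b + ∑ i, (deriv (g i) (x : ℂ)).re + K * x := fun x hx =>
    (hF' x (Ioo_subset_Icc_self hx)).deriv
  have hF'' : ∀ x ∈ Set.Ioo (h / 2) (2 * h),
      HasDerivAt (deriv F) (∑ i, (iteratedDeriv 2 (g i) (x : ℂ)).re + K) x := by
    intro x hx
    have hform : HasDerivAt (fun t : ℝ => b + ∑ i, (deriv (g i) (t : ℂ)).re + K * t)
        (∑ i, (iteratedDeriv 2 (g i) (x : ℂ)).re + K) x := by
      have hq : HasDerivAt (fun t : ℝ => K * t) K x := by simpa using (hasDerivAt_id x).const_mul K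
      exact (hG'' x hx).add hq
    refine hform.congr_of_eventuallyEq ?_
    filter_upwards [isOpen_Ioo.mem_nhds hx] with y hy
    exact hderivF y hy
  -- convexity of F on the window
  have hconv : ConvexOn ℝ (Set.Icc (h / 2) (2 * h)) F := by
    refine convexOn_of_deriv2_nonneg (convex_Icc _ _) ?_ ?_ ?_ ?_
    · exact fun t ht => (hF' t ht).continuousAt.continuousWithinAt
    · rw [interior_Icc]; exact fun x hx => (hF' x (Ioo_subset_Icc_self hx)).differentiableAt.differentiableWithinAt
    · rw [interior_Icc]; exact fun x hx => (hF'' x hx).differentiableAt.differentiableWithinAt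
    · rw [interior_Icc]
      intro x hx
      have h2 : deriv^[2] F x = deriv (deriv F) x := rfl
      rw [h2, (hF'' x hx).deriv]
      have hx' : x ∈ Set.Icc (h / 2) (2 * h) := Ioo_subset_Icc_self hx
      have hbound : ∀ i, |(iteratedDeriv 2 (g i) (x : ℂ)).re| ≤ 8 * s i / r i ^ 2 := fun i =>
        (Complex.abs_re_le_norm _).trans (hcauchy x hx' i)
      have : -K ≤ ∑ i, (iteratedDeriv 2 (g i) (x : ℂ)).re := by
        rw [hK, ← Finset.sum_neg_distrib]
        exact Finset.sum_le_sum fun i _ => by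
          have := hbound i
          rw [abs_le] at this
          linarith [this.1]
      linarith
  -- the three-point convex combination h = (1/3)(2h) + (2/3)(h/2)
  have hmem1 : 2 * h ∈ Set.Icc (h / 2) (2 * h) := ⟨by linarith, le_rfl⟩
  have hmem2 : h / 2 ∈ Set.Icc (h / 2) (2 * h) := ⟨le_rfl, by linarith⟩
  have hmemh : h ∈ Set.Icc (h / 2) (2 * h) := ⟨by linarith, by linarith⟩
  have key := hconv.2 hmem1 hmem2 (by norm_num : (0:ℝ) ≤ 1 / 3) (by norm_num : (0:ℝ) ≤ 2 / 3) (by norm_num)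
  have hcomb : (1 / 3 : ℝ) • (2 * h) + (2 / 3 : ℝ) • (h / 2) = h := by
    simp only [smul_eq_mul]; ring
  rw [hcomb] at key
  simp only [smul_eq_mul] at key
  -- unfold F at the three points and use E = G there
  have hFh : F h = E h + K / 2 * h ^ 2 := by rw [hF, hG, hE h hmemh]
  have hF2 : F (2 * h) = E (2 * h) + K / 2 * (2 * h) ^ 2 := by rw [hF, hG, hE (2 * h) hmem1]
  have hF1 : F (h / 2) = E (h / 2) + K / 2 * (h / 2) ^ 2 := by rw [hF, hG, hE (h / 2) hmem2]
  rw [hFh, hF2, hF1] at key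
  have hKsum : K = 8 * ∑ i, s i / r i ^ 2 := by
    rw [hK, Finset.mul_sum]; refine Finset.sum_congr rfl fun i _ => by ring
  nlinarith [key, hKsum]

end DrefuteCurvature
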